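import Mathlib
import HarnessLib
import Literature.Analysis.FluidPDE.Tao2016AveragedNS.TaylorChainCertificate
import Summits.NavierStokesRegularity.NavierStokesRegularity.Theorems.TaylorModelRungThreeReadoutPackage
import Summits.NavierStokesRegularity.NavierStokesRegularity.Theorems.TaylorModelRungThreeReadoutG3Base
import Summits.NavierStokesRegularity.NavierStokesRegularity.Theorems.TaylorModelRungThreeReadoutG3Flow

/-!
# Line `taylor-model` on crux K1b-DR (stmt-NavierStokesRegularity-23954) — stub G3 (`stub_tube : TubeLip`),
# helper file 3: geometry of κ-restarts and the κ-TUBE block `KBlockTube`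

For a valid certificate `cd`, an abstract flow package `φ` (`IsFlowPackage cd φ`) with the chain enclosure
(`ChainEnclosure cd φ`, stub G1's conclusion) and ANY crossing-time map `τ` with the internal crossing facts
(`Crossing cd φ τ`, stub G2's conclusion; only `τ j q ≤ Tn j (S j)` is used):

* RESTART GEOMETRY (namespace `…TaylorModelReadout.G3`, reused by the LIP half): for a state `z` κ-close to the
  trajectory of an entry point `q` at a time `t` of sub-step `s'`, the chain enclosure's restart clause (C4)
  gives the size bounds `|φ(q,t)| ≤ mT s' + SpO s'` (self-restart), `|φ(z, Tn v − t)| ≤ mT v + SpO v` and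
  `φ(z, Tn v − t) ∈ x v + Ball(ρO v)` at the later nodes, and the flow property between nodes;
* `kBlockTube_of`: K1b-DR's κ-tube ODE clause `KBlockTube cd φ τ` — the restarted flow solves on
  `[0, τ j q − t] ⊆ [0, Tn S − t]` (C4 + `HasDerivWithinAt.mono`) and obeys the window bounds `|φ j z i k t'| ≤ M k`
  (in-step `SpO` enclosures of (C4) + the certificate's window `M`-bound clause + `Λ δ τs ω ≥ 0 < mm`).

MODEL-lattice bookkeeping only (rung TL-M3 of the NS ladder); nothing here is a statement about the
Navier–Stokes equations.
-/

noncomputable section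

-- the sub-problem namespace repeats the summit name by design (D-0017)
set_option linter.dupNamespace false

namespace Summit.NavierStokesRegularity.NavierStokesRegularity.Theorems.TaylorModelReadout.G3

open Set Filter
open Literature.Analysis.FluidPDE.TaoCascade Literature.Analysis.FluidPDE.TaoCascade.TaylorChain
open Summit.NavierStokesRegularity.NavierStokesRegularity.Theorems.TaylorModelReadout

variable {cd : CertData} {j : ℕ} {φ : Flow}

/-! ### Restart geometry from the chain enclosure -/

/-- The K1b-DR tube hypothesis `|z i k − φ j q i k t| ≤ κ ω` is membership of `z − φ(q,t)` in `Ball(κ)`. [folklore] -/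
theorem inBall_of_tube {q z : Fin 4 → ℤ → ℝ} {t κ : ℝ}
    (hz : ∀ i k, -cd.Kb ≤ k → k ≤ cd.Ka → |z i k - φ j q i k t| ≤ κ * cd.ω j k) :
    cd.InBall j (z - stAt φ j q t) κ := fun i k hk1 hk2 => by
  simpa only [Pi.sub_apply, stAt] using hz i k hk1 hk2

/-- SELF-RESTART size bound: the trajectory point `φ(q,t)` at a time `t` of sub-step `s'` lies in
`Ball(mT s' + SpO s')`. [folklore] -/
theorem inBall_traj (hV : cd.Valid) (hC : ChainEnclosure cd φ) (hj : j ≤ cd.N₀)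
    {q : Fin 4 → ℤ → ℝ} (hq : InPoly cd j q) {s' : ℕ} (hs' : s' < cd.S j) {t : ℝ} (h1 : cd.Tn j s' ≤ t)
    (h2 : t ≤ cd.Tn j (s' + 1)) : cd.InBall j (stAt φ j q t) (cd.mT j s' + cd.SpO j s') := by
  have hω := omega_pos hV hj
  have hz0 : cd.InBall j (stAt φ j q t - stAt φ j q t) (cd.κ j) := by
    rw [sub_self]; exact inBall_zero hω (kappa_pos hV hj).le
  obtain ⟨hsol, hin, -, -⟩ := (hC j hj q hq).2.2.2 s' hs' t h1 h2 (stAt φ j q t) hz0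
  have hw := (hin 0 le_rfl (by linarith)).2
  have h0 := inBall_stAt_zero_sub hsol
  have hTn := Tn_succ hV hj hs'
  have hTP := ((hV.2.2.1 j hj).2.2.2.2.2.2.2 s' hs').2.2.2.2.1 (t - cd.Tn j s' + 0)
    ⟨by linarith, by linarith⟩
  have h := inBall_add (inBall_add (inBall_sub_comm h0) hw) hTP
  rw [sub_add_sub_cancel, sub_add_cancel, zero_add, add_comm] at h
  exact h

/-- Size bound at the later nodes of a κ-restarted flow: `φ(z, Tn v − t) ∈ Ball(mT v + SpO v)`. [folklore] -/
theorem inBall_restart_node (hV : cd.Valid) (hC : ChainEnclosure cd φ) (hj : j ≤ cd.N₀)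
    {q : Fin 4 → ℤ → ℝ} (hq : InPoly cd j q) {s' : ℕ} (hs' : s' < cd.S j) {t : ℝ} (h1 : cd.Tn j s' ≤ t)
    (h2 : t ≤ cd.Tn j (s' + 1)) {z : Fin 4 → ℤ → ℝ} (hz : cd.InBall j (z - stAt φ j q t) (cd.κ j))
    {v : ℕ} (hv : s' < v) (hvS : v < cd.S j) :
    cd.InBall j (stAt φ j z (cd.Tn j v - t)) (cd.mT j v + cd.SpO j v) := by
  obtain ⟨-, -, -, hlater⟩ := (hC j hj q hq).2.2.2 s' hs' t h1 h2 z hz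
  have hw := hlater v hv hvS 0 ⟨le_rfl, (h_pos hV hj hvS).le⟩
  rw [add_zero] at hw
  have hTP := ((hV.2.2.1 j hj).2.2.2.2.2.2.2 v hvS).2.2.2.2.1 0 ⟨le_rfl, (h_pos hV hj hvS).le⟩
  have h := inBall_add hw hTP
  rw [sub_add_cancel, add_comm] at h
  exact h

/-- Node enclosure of a κ-restarted flow (level `EO`): `φ(z, Tn v − t) ∈ x v + Ball(ρO v)` at every later node.
[folklore] -/
theorem inBall_restart_node_sub_centre (hV : cd.Valid) (hC : ChainEnclosure cd φ) (hj : j ≤ cd.N₀)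
    {q : Fin 4 → ℤ → ℝ} (hq : InPoly cd j q) {s' : ℕ} (hs' : s' < cd.S j) {t : ℝ} (h1 : cd.Tn j s' ≤ t)
    (h2 : t ≤ cd.Tn j (s' + 1)) {z : Fin 4 → ℤ → ℝ} (hz : cd.InBall j (z - stAt φ j q t) (cd.κ j))
    {v : ℕ} (hv : s' < v) (hvS : v ≤ cd.S j) :
    cd.InBall j (stAt φ j z (cd.Tn j v - t) - cd.x j v) (cd.ρO j v) := by
  obtain ⟨-, -, hnode, -⟩ := (hC j hj q hq).2.2.2 s' hs' t h1 h2 z hz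
  obtain ⟨ξ, e, hξe, he⟩ := hnode v hv hvS
  have hCm := (para_inBall hV hj hvS ξ fun i k hk1 hk2 => (hξe i k hk1 hk2).1).2
  have h0 := inBall_add hCm he
  rw [sub_add_cancel] at h0
  intro i k hk1 hk2
  have h := h0 i k hk1 hk2
  simp only [Pi.add_apply] at h
  simp only [Pi.sub_apply, stAt, (hξe i k hk1 hk2).2]
  calc |cd.x j v i k + cd.Cm j v ξ i k + e i k - cd.x j v i k| = |cd.Cm j v ξ i k + e i k| := by ring_nf
    _ ≤ cd.ρO j v * cd.ω j k := h

/-- FLOW PROPERTY between nodes for a κ-restarted flow: `φ(z, Tn (v+1) − t) = φ(φ(z, Tn v − t), h v)`.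
[folklore] -/
theorem stAt_restart_succ (hV : cd.Valid) (hF : IsFlowPackage cd φ) (hC : ChainEnclosure cd φ)
    (hj : j ≤ cd.N₀) {q : Fin 4 → ℤ → ℝ} (hq : InPoly cd j q) {s' : ℕ} (hs' : s' < cd.S j) {t : ℝ}
    (h1 : cd.Tn j s' ≤ t) (h2 : t ≤ cd.Tn j (s' + 1)) {z : Fin 4 → ℤ → ℝ}
    (hz : cd.InBall j (z - stAt φ j q t) (cd.κ j)) {v : ℕ} (hv : s' + 1 ≤ v) (hvS : v < cd.S j) :
    stAt φ j z (cd.Tn j (v + 1) - t) = stAt φ j (stAt φ j z (cd.Tn j v - t)) (cd.h j v) := by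
  obtain ⟨hsol, -, -, -⟩ := (hC j hj q hq).2.2.2 s' hs' t h1 h2 z hz
  have hv1 : cd.Tn j (s' + 1) ≤ cd.Tn j v := Tn_mono hV hj hv hvS.le
  have hv2 : cd.Tn j (v + 1) ≤ cd.Tn j (cd.S j) := Tn_mono hV hj (by omega) le_rfl
  have hTn := Tn_succ hV hj hvS
  have h := stAt_shift hF hj hsol (T₁ := cd.Tn j v - t) (s := cd.h j v) (by linarith)
    ⟨(h_pos hV hj hvS).le, by linarith⟩
  rw [← h, hTn]
  ring_nf

/-- FLOW PROPERTY from a node to an in-step time for a κ-restarted flow: for `Tn v ≤ t + T' ≤ Tn S` (`v` a later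
node), `φ(z, T') = φ(φ(z, Tn v − t), t + T' − Tn v)`. [folklore] -/
theorem stAt_restart_at (hV : cd.Valid) (hF : IsFlowPackage cd φ) (hC : ChainEnclosure cd φ)
    (hj : j ≤ cd.N₀) {q : Fin 4 → ℤ → ℝ} (hq : InPoly cd j q) {s' : ℕ} (hs' : s' < cd.S j) {t : ℝ}
    (h1 : cd.Tn j s' ≤ t) (h2 : t ≤ cd.Tn j (s' + 1)) {z : Fin 4 → ℤ → ℝ}
    (hz : cd.InBall j (z - stAt φ j q t) (cd.κ j)) {v : ℕ} (hv : s' + 1 ≤ v) (hvS : v ≤ cd.S j)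
    {T' : ℝ} (hT'1 : cd.Tn j v ≤ t + T') (hT'2 : t + T' ≤ cd.Tn j (cd.S j)) :
    stAt φ j z T' = stAt φ j (stAt φ j z (cd.Tn j v - t)) (t + T' - cd.Tn j v) := by
  obtain ⟨hsol, -, -, -⟩ := (hC j hj q hq).2.2.2 s' hs' t h1 h2 z hz
  have hv1 : cd.Tn j (s' + 1) ≤ cd.Tn j v := Tn_mono hV hj hv hvS
  have h := stAt_shift hF hj hsol (T₁ := cd.Tn j v - t) (s := t + T' - cd.Tn j v) (by linarith)
    ⟨by linarith, by linarith⟩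
  rw [← h]
  ring_nf

/-! ### The κ-tube block -/

/-- **K1b-DR's κ-TUBE ODE clause** for an abstract flow package with the chain enclosure and a crossing-time
map in the last sub-step: restarted flows from κ-close states solve on `[0, τ j q − t]` with the window bounds
`|φ j z i k t'| ≤ M k`. [folklore] -/
theorem kBlockTube_of (hV : cd.Valid) (hC : ChainEnclosure cd φ) {τ : Cross}
    (hX : Crossing cd φ τ) : KBlockTube cd φ τ := by
  intro j hj q hq t ht z hz i k hk1 hk2
  obtain ⟨-, hτ2, -, -, -, -⟩ := hX j hj q hq
  have hS := one_le_S hV hj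
  have hω := omega_pos hV hj
  obtain ⟨s', -, hs'S, hs't, hts'⟩ := exists_substep (cd := cd) (j := j) (s₀ := 0) (by omega)
    (by rw [Tn_zero hV hj]; exact ht.1) (ht.2.trans hτ2)
  have hzb : cd.InBall j (z - stAt φ j q t) (cd.κ j) := inBall_of_tube hz
  obtain ⟨hsol, hin, -, hlater⟩ := (hC j hj q hq).2.2.2 s' hs'S t hs't hts' z hzb
  refine ⟨(hsol i k hk1 hk2).1, fun t' ht' => ⟨?_, ?_⟩⟩
  · exact ((hsol i k hk1 hk2).2 t' ⟨ht'.1, by linarith [ht'.2]⟩).mono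
      (Icc_subset_Icc_right (by linarith))
  · -- the window M-bound at time t + t'
    have hpos : 0 ≤ cd.Λ j * cd.δ j * cd.τs * cd.ω j k :=
      mul_nonneg (mul_nonneg (mul_nonneg (Lambda_nonneg hV hj) (delta_nonneg hV hj)) (taus_pos hV).le)
        (hω k).le
    have hmm := mm_pos hV
    obtain ⟨s'', hs's'', hs''S, hT1, hT2⟩ := exists_substep (cd := cd) (j := j) (s₀ := s') hs'S
      (by linarith [ht'.1] : cd.Tn j s' ≤ t + t') (by linarith [ht'.2] : t + t' ≤ cd.Tn j (cd.S j))
    have hM := ((hV.2.2.1 j hj).2.2.2.2.2.2.2 s'' hs''S).2.2.2.2.2.2.2.2.2.2.2.2.2.2.2.2.2.2.2.2.2.2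
    have hTn := Tn_succ hV hj hs''S
    rcases Nat.eq_or_lt_of_le hs's'' with heq | hlt
    · subst heq
      have hw := (hin t' ht'.1 hT2).2
      have h := hM (t - cd.Tn j s' + t') ⟨by linarith, by linarith⟩ _ hw i k hk1 hk2
      simp only [Pi.add_apply, Pi.sub_apply, stAt, add_sub_cancel] at h
      linarith
    · have hw := hlater s'' hlt hs''S (t + t' - cd.Tn j s'') ⟨by linarith, by linarith⟩
      have e : cd.Tn j s'' - t + (t + t' - cd.Tn j s'') = t' := by ring
      rw [e] at hw
      have h := hM (t + t' - cd.Tn j s'') ⟨by linarith, by linarith⟩ _ hw i k hk1 hk2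
      simp only [Pi.add_apply, Pi.sub_apply, stAt, add_sub_cancel] at h
      linarith

end Summit.NavierStokesRegularity.NavierStokesRegularity.Theorems.TaylorModelReadout.G3

end
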